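import Summits.KontsevichZagierPeriods.Zeta5Search.WedgeDictionaryCoeffV
import Summits.KontsevichZagierPeriods.Zeta5Search.WedgeDictionaryClosedForms
import HarnessLib

/-!
# The rank-three Casoratian `det(U, W, V)` along slot 7: Abel's step and the closed form CF-W3 (conjecture)

HONEST FRAMING: systematic search; no irrationality claim unless certified.

OUR work (Summit side; planner gen-1 g5, 2026-08-20; memo `pub-zeta5-gen-1/D2-FEASIBILITY-g5.md` §3).
`U = coeffU`, `W = coeffW`, `V = coeffV` are three solutions of one four-term relation along slot 7
(`fourTerm_coeff_rel_UWV`, `WedgeDictionaryCoeffV`).  Their 3×3 Casoratian at three consecutive slot points,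
`cas3 b = det[(U,W,V)(b); (U,W,V)(b+e₇); (U,W,V)(b+2e₇)]`, therefore obeys ABEL'S FIRST-ORDER STEP
`γ₃(b)·cas3(b+e₇) + γ₀(b)·cas3(b) = 0` (`cas3_abel_step`, proved here; `γ₃ = −(d−1)`, `γ₀ = (b₇+1)∏_{k≤6}(N−b₇−b_k)`,
`topGamma3_eq`, `topGamma0_eq`).

**CF-W3 (conjecture `rankThreeClosedForm`, INTERNALLY MINTED — exact instances only):**
`cas3(b) · ∏_{1≤j<k≤7} (N − b_j − b_k)! = (−1)^{N+1} · 4 · (d−1)! · ∏_{j=1}^{7} b_j!`  (`d = 3N − Σ_j b_j ≥ 1`, all 21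
pair sums `≤ N`, `b₇ + 2 ≤ N`).  Evidence: 128 exact instances with independent partial-fraction code (`code/gen1/g5/`:
`w3fit.py` 36 structured shapes N = 6,7,8; `w3sweep.py` 92 random admissible shapes incl. faces, N = 4..13), the Abel
ratio `(b₇+1)∏_{k≤6}(N−b₇−b_k)/(d−1)` (6/6), and `cas3` at slot-7 points `=` the `Φ, yΦ, y²Φ` determinant (6/6).
Compare CF-M3's face product `(−1)^N 4 d! ∏_j (N−b_j)!/(N! ∏_{j<k}(N−b_j−b_k)!)`: here `∏ b_j!` replaces `∏(N−b_j)!/N!`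
and `(d−1)!` replaces `d!`; the harmonic numbers inside `V` cancel in the determinant.
Proof route (memo §3): `cas3_abel_step` along every slot (slot symmetry of `U, W, V`) + descent to the corner
`(N; 0,…,0)` + BASE(N): `cas3(N;0⁷) = (−1)^{N+1}·4·(3N−1)!/(N!)^{21}` (the pf data of the bare kernel
`(2x+N)/((x)_{N+1})⁶`; the only non-mechanical step).
Consequence (memo §3, assuming the P-parts of the wedge dictionary): Apéry-type determinant identities for
Brown–Zudilin's coefficients along a slot, e.g. `Q(a)P̂(a′) − P̂(a)Q(a′) = ρ(a)ρ(a′)·cas3(b)·U(b+e₇)` (checked 5/5 against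
(17) and the corrected (22′)).  What this is NOT: a statement about irrationality.
-/

open Finset Polynomial

namespace Summit.KontsevichZagierPeriods.Zeta5Search.WedgeDictionary

open Summit.KontsevichZagierPeriods.Zeta5Search.DualSeries

/-- The rank-three Casoratian of `(U, W, V)` at the slot-7 points `b, b+e₇, b+2e₇`. -/
noncomputable def cas3 (b : ℕ → ℤ) : ℚ :=
  coeffU b * (coeffW (bump b 6) * coeffV (bump (bump b 6) 6) - coeffV (bump b 6) * coeffW (bump (bump b 6) 6)) -
    coeffW b * (coeffU (bump b 6) * coeffV (bump (bump b 6) 6) - coeffV (bump b 6) * coeffU (bump (bump b 6) 6)) +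
    coeffV b * (coeffU (bump b 6) * coeffW (bump (bump b 6) 6) - coeffW (bump b 6) * coeffU (bump (bump b 6) 6))

/-- **Abel's step for a 3×3 Casoratian, abstract form**: three solutions `x, y, z` of one four-term relation. -/
theorem det3_abel_of_fourTerm {γ0 γ1 γ2 γ3 x0 x1 x2 x3 y0 y1 y2 y3 z0 z1 z2 z3 : ℚ}
    (hx : γ3 * x3 + γ2 * x2 + γ1 * x1 + γ0 * x0 = 0) (hy : γ3 * y3 + γ2 * y2 + γ1 * y1 + γ0 * y0 = 0)
    (hz : γ3 * z3 + γ2 * z2 + γ1 * z1 + γ0 * z0 = 0) :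
    γ3 * (x1 * (y2 * z3 - z2 * y3) - y1 * (x2 * z3 - z2 * x3) + z1 * (x2 * y3 - y2 * x3)) +
      γ0 * (x0 * (y1 * z2 - z1 * y2) - y0 * (x1 * z2 - z1 * x2) + z0 * (x1 * y2 - y1 * x2)) = 0 := by
  linear_combination (y1 * z2 - z1 * y2) * hx + (z1 * x2 - x1 * z2) * hy + (x1 * y2 - y1 * x2) * hz

/-- **Abel's first-order step for `cas3` along slot 7**: for `b` in the box with `d(b) ≥ 2` and `b₇ + 2 ≤ N`,
`γ₃(b)·cas3(b+e₇) + γ₀(b)·cas3(b) = 0`. -/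
theorem cas3_abel_step (b : ℕ → ℤ) (hb : InBox b) (hd : 2 ≤ dOf b) (h7 : b 7 + 2 ≤ b 0) :
    topGamma3 b * cas3 (bump b 6) + topGamma0 b * cas3 b = 0 := by
  obtain ⟨hU, hW, hV⟩ := fourTerm_coeff_rel_UWV b hb hd h7
  unfold cas3
  exact det3_abel_of_fourTerm hU hW hV

/-- **CONJECTURE CF-W3 (closed form of the rank-three Casoratian; INTERNALLY MINTED — 128 exact instances
(`code/gen1/g5/w3sweep.py`, `w3fit.py`), numerics only).**  For `b` in the box with `b₇ + 2 ≤ b₀`, `d(b) ≥ 1` and all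
21 pair sums `b_j + b_k ≤ b₀`:
`cas3(b) · ∏_{1≤j<k≤7} (b₀ − b_j − b_k)! = (−1)^{b₀+1} · 4 · (d(b)−1)! · ∏_{j=1}^{7} b_j!`. -/
@[conjecture] def rankThreeClosedForm : Prop :=
  ∀ b : ℕ → ℤ, InBox b → b 7 + 2 ≤ b 0 → 1 ≤ dOf b → (∀ jk ∈ allPairs, b jk.1 + b jk.2 ≤ b 0) →
    cas3 b * (allPairs.map fun jk => ((b 0 - b jk.1 - b jk.2).toNat.factorial : ℚ)).prod =
      (-1 : ℚ) ^ ((b 0).toNat + 1) * 4 * ((dOf b - 1).toNat.factorial : ℚ) *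
        ∏ j ∈ range 7, ((b (j + 1)).toNat.factorial : ℚ)


end Summit.KontsevichZagierPeriods.Zeta5Search.WedgeDictionary
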